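import Literature.NumberTheory.EllipticCurves.CuspFormTwist
import Literature.NumberTheory.EllipticCurves.CuspFormLFunctionProofs
import Mathlib.Analysis.MellinTransform
import HarnessLib

/-!
# The harmonic `GL(2)` family: Hecke eigenvalues `λ_f(n)`, harmonic weights `ω_f`, central values
`L(f, ½)` and twisted central values `L(f ⊗ ψ, ½)`

Vocabulary for the *family route* to the exceptional character (Iwaniec–Sarnak 2000; Iwaniec–Kowalski
2004, Ch. 14 and Ch. 26; Kowalski–Michel 2000): averages of central values of Hecke `L`-functions over
the newforms `f ∈ H_k(q)` of level `q` and weight `k`, with the *harmonic* weight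

`ω_f = Γ(k−1) (4π)^{1−k} ⟨f, f⟩⁻¹`   (Iwaniec–Kowalski (14.60): `∑ʰ_f α_f := Γ(k−1)(4π)^{1−k} ∑_f α_f/‖f‖²`),

the normalised Hecke eigenvalues `λ_f(n)` defined by `f(z) = ∑ λ_f(n) n^{(k−1)/2} e(nz)` for a
Hecke-normalised form (Iwaniec–Kowalski §14.10, display before (14.59)), and the `L`-function in the
*analytic* normalisation `L(f, s) = ∑ λ_f(n) n^{−s}` whose central point is `s = ½` (Iwaniec–Kowalski
(14.55) and §26.2). Everything here is a DEFINITION with a body over the tree's modular-form vocabulary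
(`cuspCoeff`, `cuspFormLSeries`, `twistedLSeries`, `IsNormalized`, `newforms0`, `peterssonProduct`,
`twistRaw`/`charTwist` of `Literature.NumberTheory.EllipticCurves.ModularForms`); there are NO named
facts in this file.

## Main definitions (namespace `Literature.NumberTheory.LFunctions.GL2Family`)

* `heckeLambda f n = λ_f(n) := a_n(f) · n^{−(k−1)/2}` (for a Hecke-normalised `f`, `a_1(f) = 1`, these
  are the Hecke eigenvalues in the analytic normalisation, `λ_f(1) = 1`).
* `cuspFormMellin f s = Λ(f, s) := ∫_0^∞ f(iy) y^{s−1} dy` (Mathlib `mellin`). For a cusp form on `Γ₀(N)`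
  (indeed on any congruence subgroup) the integrand decays rapidly at `0` and `∞`, so this is an ENTIRE
  function of `s` given by an absolutely convergent integral for every `s`; for `re s > k/2 + 1` it equals
  `(2π)^{−s} Γ(s) ∑ a_n(f) n^{−s}` (the tree's PROVED `cuspFormLSeries_eq_mellin_holds`). It is the
  level-free completed `L`-function (`Λ_N(f, s) = N^{s/2} Λ(f, s)` in the notation of
  `completedCuspFormL`); for level one it is literally the tree's `cuspFormLambda`
  (`DavenportHeilbronnDegreeTwo`).
* `cuspFormLStar f s = L^*(f, s) := (2π)^s Γ(s)⁻¹ Λ(f, s)`: the entire continuation of the classical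
  `L`-series `∑ a_n(f) n^{−s}` (agrees with `cuspFormLSeries f s` on `re s > k/2 + 1`:
  `cuspFormLStar_eq_cuspFormLSeries`).
* `centralValue f = L(f, ½)` in the ANALYTIC normalisation `:= L^*(f, k/2)` (for Hecke-normalised `f`,
  `∑ λ_f(n) n^{−s} = ∑ a_n(f) n^{−s−(k−1)/2}`, so the analytic central point `½` is the classical
  point `k/2`), and `centralDeriv f = L'(f, ½) := (L^*)'(f, k/2)`.
* `harmonicWeight f = ω_f := Γ(k−1) / ((4π)^{k−1} ⟨f, f⟩)` with `⟨f, f⟩ = peterssonProduct (Γ₀(N)) k f f`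
  (the tree's Petersson product: `∫_{Γ₀(N)\ℍ} |f|² y^k dμ`, no volume normalisation — exactly
  Iwaniec–Kowalski (14.11)); `harmonicSum N k α = ∑ʰ_{f ∈ H_k(N)} α_f := ∑_{f ∈ newforms0 N k} ω_f α_f`
  (a `finsum`; `newforms0 N k` is finite, `finite_newforms0`).
* `twistedCentralValue f ψ = L(f ⊗ ψ, ½)` for a PRIMITIVE `ψ mod m`: the central value of the raw
  Shimura twist `twistRaw (N m²) f ψ = g(ψ̄) ∑ ψ(n) a_n(f) qⁿ ∈ S_k(Γ₁(N m²))` (tree, PROVED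
  `cuspCoeff_twistRaw`) divided by the Gauss sum `g(ψ̄) = g(ψ⁻¹) ≠ 0`
  (`gaussSum_stdAddChar_ne_zero_of_isPrimitive`). Its `L`-series is the tree's `twistedLSeries f ψ`
  (`cuspFormLSeries_twistRaw`), so this IS the value at the centre of the entire continuation of
  `L(f ⊗ ψ, s) = ∑ ψ(n) a_n(f) n^{−s}`; `twistedCentralDeriv` likewise.

## Design notes

* Why Mellin and not `completedCuspFormLContinuations`: the Mellin integral of `y ↦ f(iy)` converges for
  EVERY `s` when `f` is a cusp form (exponential decay at both ends of the imaginary axis), so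
  `cuspFormMellin` is the continuation itself, with no choice and no junk value; the set
  `completedCuspFormLContinuations N f` of `CuspFormLFunction` is then `{s ↦ N^{s/2} Λ(f, s)}` (not
  re-proved here). This is the route already taken for level one by the tree's `cuspFormLambda`
  (`DavenportHeilbronnDegreeTwo`, not imported here to keep the import graph light; the two bodies
  are syntactically identical).
* `Γ(s)⁻¹` is entire, and Mathlib's `Complex.Gamma` is never `0` (junk values at the poles are non-zero
  only off the poles; at `s = k/2 ≥ 1` there is no pole), so `cuspFormLStar` is the honest entire
  `L`-function at every `s` with `Γ(s) ≠ 0`, in particular on `re s > 0`.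
* `λ_f(n)` uses the principal branch `(n : ℂ) ^ (−(k−1)/2)`, real and positive for `n ≥ 1`; `λ_f(0) = 0`
  (`a_0(f) = 0` for cusp forms is not needed: `0 ^ (−(k−1)/2) = 0` for `k ≠ 1`).
* Harmonic sums are `finsum`s over the SET `newforms0 N k` (junk `0` only if that set were infinite,
  which `finite_newforms0` excludes); no `Finset`/`Fintype` plumbing is forced on users.
* Twists: the raw twist lives on `Γ₁(N m²)` for every `ψ` (the quadratic case descends to `Γ₀(N m²)` as
  the tree's `charTwist`, and `twistedCentralValue_eq_centralValue_charTwist` records the agreement).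
  Coprimality `(m, N) = 1` is NOT assumed by the definition (it is a hypothesis of the theorems that use
  it, e.g. Iwaniec–Kowalski Prop. 14.20).
* What is NOT here: no statement of any theorem of Iwaniec–Sarnak / Kowalski–Michel (they live in the
  files citing this one); no natural (unweighted) averages beyond the plain counting set `newforms0`;
  no Maass forms.

## References

* H. Iwaniec, E. Kowalski, *Analytic Number Theory*, AMS Colloquium Publ. 53 (2004), §14.2 (14.11),
  §14.7 (Hecke/Petersson normalisation), §14.8 (14.52) and Prop. 14.20 (twists), §14.10 (14.59)–(14.60),
  §26.2 (26.3), (26.5)–(26.6). [held: Chinese translation, book:anonnd-untitled-gx66728485, p0211,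
  p0220–p0224, p0331]
* E. Kowalski, P. Michel, *A lower bound for the rank of `J_0(q)`*, Acta Arith. 94 (2000) 303–343, §2
  (harmonic average `∑ʰ α_f = ∑ α_f/(4π(f,f))`, weight 2). [held: paper:doi-10-4064-aa-94-4-303-343]
* H. Iwaniec, P. Sarnak, *The non-vanishing of central values of automorphic `L`-functions and
  Landau–Siegel zeros*, Israel J. Math. 120 (2000) 155–177. [not held: acq-11417]
* G. Shimura, *Introduction to the arithmetic theory of automorphic functions* (1971), Prop. 3.64,
  Thm. 3.66 (twists).
-/

noncomputable section

open scoped MatrixGroups ModularForm Real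

open CongruenceSubgroup UpperHalfPlane Complex

namespace Literature.NumberTheory.LFunctions.GL2Family

open Literature.NumberTheory.EllipticCurves.ModularForms

/-! ### Hecke eigenvalues in the analytic normalisation -/

section Lambda

variable {Γ : Subgroup (GL (Fin 2) ℝ)} {k : ℤ}

/-- The **normalised Hecke eigenvalue** `λ_f(n) := a_n(f) n^{−(k−1)/2}` of a cusp form of weight `k`,
so that `f(z) = ∑_{n ≥ 1} λ_f(n) n^{(k−1)/2} e(nz)` (Iwaniec–Kowalski §14.10, the display before
(14.59); for weight `2`, `f(z) = ∑ λ_f(n) √n e(nz)`, §26.2). For a Hecke-normalised newform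
(`IsNormalized f`, `a_1 = 1`) these are its Hecke eigenvalues with `λ_f(1) = 1` and Deligne's bound
reads `|λ_f(n)| ≤ τ(n)`. [cite: IwaniecKowalski2004, §14.10 (display before (14.59)); §26.2] -/
def heckeLambda (f : CuspForm Γ k) (n : ℕ) : ℂ :=
  cuspCoeff f n * (n : ℂ) ^ (-(((k : ℂ) - 1) / 2))

/-- Unfolding `heckeLambda` (Iwaniec–Kowalski §14.10). [cite: IwaniecKowalski2004, §14.10 (display before (14.59))] -/
theorem heckeLambda_def (f : CuspForm Γ k) (n : ℕ) :
    heckeLambda f n = cuspCoeff f n * (n : ℂ) ^ (-(((k : ℂ) - 1) / 2)) :=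
  rfl

/-- `λ_f(1) = a_1(f)`; in particular `λ_f(1) = 1` for a Hecke-normalised form (Iwaniec–Kowalski §14.7).
[cite: IwaniecKowalski2004, §14.7] -/
theorem heckeLambda_one (f : CuspForm Γ k) : heckeLambda f 1 = cuspCoeff f 1 := by
  simp [heckeLambda]

/-- For a Hecke-normalised form (`a_1(f) = 1`), `λ_f(1) = 1` (Iwaniec–Kowalski §14.7).
[cite: IwaniecKowalski2004, §14.7] -/
theorem heckeLambda_one_of_isNormalized {f : CuspForm Γ k} (hf : IsNormalized f) :
    heckeLambda f 1 = 1 := by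
  rw [heckeLambda_one]
  exact (isNormalized_iff_cuspCoeff_one f).mp hf

/-- Recovering the Fourier coefficient: `a_n(f) = λ_f(n) n^{(k−1)/2}` for `n ≥ 1` (Iwaniec–Kowalski §14.10,
the display before (14.59)). [cite: IwaniecKowalski2004, §14.10 (display before (14.59))] -/
theorem cuspCoeff_eq_heckeLambda_mul (f : CuspForm Γ k) {n : ℕ} (hn : n ≠ 0) :
    cuspCoeff f n = heckeLambda f n * (n : ℂ) ^ (((k : ℂ) - 1) / 2) := by
  have hn' : (n : ℂ) ≠ 0 := Nat.cast_ne_zero.mpr hn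
  rw [heckeLambda, mul_assoc, ← Complex.cpow_add _ _ hn', neg_add_cancel, Complex.cpow_zero, mul_one]

end Lambda

/-! ### The completed `L`-function as a Mellin transform, central values and derivatives -/

section Central

variable {Γ : Subgroup (GL (Fin 2) ℝ)} {k : ℤ}

/-- The **completed `L`-function as a Mellin transform**, `Λ(f, s) := ∫_0^∞ f(iy) y^{s−1} dy`
(Mathlib `mellin` of `y ↦ f(iy)`). For a cusp form the integral converges absolutely for every
`s ∈ ℂ` (rapid decay of `f(iy)` as `y → ∞` and as `y → 0⁺`), so this is an entire function; on
`re s > k/2 + 1` it equals `(2π)^{−s} Γ(s) L(f, s)` (`cuspFormLSeries_eq_mellin_holds`), i.e. it is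
the level-free completed `L`-function `Λ_N(f, s) N^{−s/2}` of Hecke (Iwaniec–Kowalski §14.6,
Thm. 14.17; Diamond–Shurman (5.35)). [cite: IwaniecKowalski2004, §14.6 (Thm. 14.17)] -/
def cuspFormMellin (f : CuspForm Γ k) (s : ℂ) : ℂ :=
  mellin (fun t : ℝ ↦ f (ofComplex (Complex.I * (t : ℂ)))) s

/-- Unfolding `cuspFormMellin` (Iwaniec–Kowalski §14.6). [cite: IwaniecKowalski2004, §14.6 (Thm. 14.17)] -/
theorem cuspFormMellin_def (f : CuspForm Γ k) (s : ℂ) :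
    cuspFormMellin f s = mellin (fun t : ℝ ↦ f (ofComplex (Complex.I * (t : ℂ)))) s :=
  rfl

/-- The **entire `L`-function** `L^*(f, s) := (2π)^s Γ(s)⁻¹ Λ(f, s)` of a cusp form: the analytic
continuation of the classical `L`-series `∑ a_n(f) n^{−s}` (`cuspFormLStar_eq_cuspFormLSeries` on the
half-plane of absolute convergence) (Hecke; Iwaniec–Kowalski §14.6). Mathlib's `Complex.Gamma` has
no zeros, so no junk value interferes at `s = k/2`, `k ≥ 2`. [cite: IwaniecKowalski2004, §14.6] -/
def cuspFormLStar (f : CuspForm Γ k) (s : ℂ) : ℂ :=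
  (2 * Real.pi : ℂ) ^ s / Complex.Gamma s * cuspFormMellin f s

/-- Unfolding `cuspFormLStar` (Iwaniec–Kowalski §14.6). [cite: IwaniecKowalski2004, §14.6] -/
theorem cuspFormLStar_def (f : CuspForm Γ k) (s : ℂ) :
    cuspFormLStar f s = (2 * Real.pi : ℂ) ^ s / Complex.Gamma s * cuspFormMellin f s :=
  rfl

/-- **`L^*(f, s) = L(f, s)` on the half-plane of absolute convergence** `re s > k/2 + 1` (levels whose
cusp at `∞` has width `1`, e.g. `Γ₀(N)`, `Γ₁(N)`): from the tree's PROVED Mellin formula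
`cuspFormLSeries_eq_mellin_holds` (Hecke 1936; Iwaniec–Kowalski §14.6). [cite: IwaniecKowalski2004, §14.6] -/
theorem cuspFormLStar_eq_cuspFormLSeries [Γ.IsArithmetic] (hΓ : Γ.strictWidthInfty = 1)
    (f : CuspForm Γ k) {s : ℂ} (hs : (k : ℝ) / 2 + 1 < s.re) :
    cuspFormLStar f s = cuspFormLSeries f s := by
  rw [cuspFormLStar, cuspFormMellin, cuspFormLSeries_eq_mellin_holds hΓ f hs]

/-- On `Γ₀(N)`: `L^*(f, s) = L(f, s)` for `re s > k/2 + 1`. [cite: IwaniecKowalski2004, §14.6] -/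
theorem cuspFormLStar_eq_cuspFormLSeries_gamma0 {N : ℕ} [NeZero N] (f : CuspForm (Gamma0 N) k) {s : ℂ}
    (hs : (k : ℝ) / 2 + 1 < s.re) : cuspFormLStar f s = cuspFormLSeries f s :=
  cuspFormLStar_eq_cuspFormLSeries (strictWidthInfty_Gamma0 N) f hs

/-- On `Γ₁(N)`: `L^*(f, s) = L(f, s)` for `re s > k/2 + 1`. [cite: IwaniecKowalski2004, §14.6] -/
theorem cuspFormLStar_eq_cuspFormLSeries_gamma1 {N : ℕ} [NeZero N] (f : CuspForm (Gamma1 N) k) {s : ℂ}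
    (hs : (k : ℝ) / 2 + 1 < s.re) : cuspFormLStar f s = cuspFormLSeries f s :=
  cuspFormLStar_eq_cuspFormLSeries (strictWidthInfty_Gamma1 N) f hs

/-- The **central value in the analytic normalisation**, `L(f, ½) := L^*(f, k/2)`: for a
Hecke-normalised `f`, `L(f, s) = ∑ λ_f(n) n^{−s}` (Iwaniec–Kowalski (14.55), §26.1) is the classical
series shifted by `(k−1)/2`, so its centre `s = ½` is the classical point `k/2`
(Iwaniec–Kowalski §26.1, Thm. 26.1; Kowalski–Michel 2000, §1 "normalized so that `Re(s) = 1/2` is the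
critical line"). [cite: IwaniecKowalski2004, §26.1 (normalisation of L(f, 1/2))] -/
def centralValue (f : CuspForm Γ k) : ℂ :=
  cuspFormLStar f ((k : ℂ) / 2)

/-- Unfolding `centralValue` (Iwaniec–Kowalski §26.1). [cite: IwaniecKowalski2004, §26.1 (normalisation of L(f, 1/2))] -/
theorem centralValue_def (f : CuspForm Γ k) : centralValue f = cuspFormLStar f ((k : ℂ) / 2) :=
  rfl

/-- The **central derivative in the analytic normalisation**, `L'(f, ½) := (d/ds) L^*(f, s)` at
`s = k/2` (the quantity mollified in Iwaniec–Kowalski §26.2, (26.5)–(26.6), and Kowalski–Michel 2000,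
§2, for odd forms). [cite: IwaniecKowalski2004, §26.2 (26.5)–(26.6)] -/
def centralDeriv (f : CuspForm Γ k) : ℂ :=
  deriv (cuspFormLStar f) ((k : ℂ) / 2)

/-- Unfolding `centralDeriv` (Iwaniec–Kowalski §26.2). [cite: IwaniecKowalski2004, §26.2 (26.5)–(26.6)] -/
theorem centralDeriv_def (f : CuspForm Γ k) :
    centralDeriv f = deriv (cuspFormLStar f) ((k : ℂ) / 2) :=
  rfl

end Central

/-! ### Harmonic weights and harmonic averages over newforms of level `Γ₀(N)` -/

section Harmonic

variable {N : ℕ} [NeZero N] {k : ℤ}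

/-- The **harmonic weight** `ω_f := Γ(k−1) / ((4π)^{k−1} ⟨f, f⟩)` of a cusp form `f ∈ S_k(Γ₀(N))`,
with `⟨f, f⟩ = ∫_{Γ₀(N)\ℍ} |f|² y^k dμ` the Petersson norm WITHOUT volume normalisation
(Iwaniec–Kowalski (14.11); the tree's `peterssonProduct (Γ₀(N)) k f f`, same convention), so that
`∑ʰ_f α_f = ∑_f ω_f α_f` is Iwaniec–Kowalski (14.60) and the Petersson formula (14.59) has diagonal
term `δ(m, n)`; for `k = 2` this is Kowalski–Michel's `1/(4π(f, f))`. Intended for Hecke-normalised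
`f` (`a_1 = 1`). Real-valued: the real part of the (positive real) Petersson norm is used.
[cite: IwaniecKowalski2004, (14.60) with (14.11)] -/
def harmonicWeight (f : CuspForm (Gamma0 N) k) : ℝ :=
  Real.Gamma ((k : ℝ) - 1) / ((4 * Real.pi) ^ (k - 1) * (peterssonProduct (Gamma0 N) k f f).re)

/-- Unfolding `harmonicWeight` (Iwaniec–Kowalski (14.60)). [cite: IwaniecKowalski2004, (14.60) with (14.11)] -/
theorem harmonicWeight_def (f : CuspForm (Gamma0 N) k) :
    harmonicWeight f =
      Real.Gamma ((k : ℝ) - 1) / ((4 * Real.pi) ^ (k - 1) * (peterssonProduct (Gamma0 N) k f f).re) :=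
  rfl

/-- For weight `k = 2`: `ω_f = 1 / (4π ⟨f, f⟩)` (Kowalski–Michel 2000, §2: `∑ʰ α_f = ∑ α_f /(4π(f,f))`;
Iwaniec–Kowalski §26.2, the remark after Thm. 26.8). [cite: IwaniecKowalski2004, §26.2 (after Thm. 26.8)] -/
theorem harmonicWeight_weight_two (f : CuspForm (Gamma0 N) 2) :
    harmonicWeight f = 1 / (4 * Real.pi * (peterssonProduct (Gamma0 N) 2 f f).re) := by
  rw [harmonicWeight]
  norm_num

variable (N k)

/-- The **harmonic average over the newforms of level `Γ₀(N)` and weight `k`**,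
`∑ʰ_{f ∈ H_k(N)} α_f := ∑_{f ∈ newforms0 N k} ω_f α_f` (Iwaniec–Kowalski (14.60) restricted to the
Hecke-normalised newforms `newforms0 N k`; for `N = q` prime and `k < 12` these are ALL the Hecke
forms, `S_k(q) = S_k^new(q)`, which is the setting `S_2(q)^*` of §26.2). A `finsum` over the finite
set `newforms0 N k` (`finite_newforms0`). [cite: IwaniecKowalski2004, (14.60); §26.2] -/
def harmonicSum (α : CuspForm (Gamma0 N) k → ℂ) : ℂ :=
  ∑ᶠ f ∈ newforms0 N k, (harmonicWeight f : ℂ) * α f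

/-- Unfolding `harmonicSum` (Iwaniec–Kowalski (14.60)). [cite: IwaniecKowalski2004, (14.60)] -/
theorem harmonicSum_def (α : CuspForm (Gamma0 N) k → ℂ) :
    harmonicSum N k α = ∑ᶠ f ∈ newforms0 N k, (harmonicWeight f : ℂ) * α f :=
  rfl

/-- The harmonic average `∑ʰ` of Iwaniec–Kowalski (14.60) is additive in the test function (on a
finite family). [cite: IwaniecKowalski2004, (14.60)] -/
theorem harmonicSum_add (hfin : (newforms0 N k).Finite) (α β : CuspForm (Gamma0 N) k → ℂ) :
    harmonicSum N k (fun f ↦ α f + β f) = harmonicSum N k α + harmonicSum N k β := by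
  simp only [harmonicSum, mul_add]
  exact finsum_mem_add_distrib hfin

/-- The harmonic average `∑ʰ` of Iwaniec–Kowalski (14.60) is homogeneous in the test function.
[cite: IwaniecKowalski2004, (14.60)] -/
theorem harmonicSum_const_mul (c : ℂ) (α : CuspForm (Gamma0 N) k → ℂ) :
    harmonicSum N k (fun f ↦ c * α f) = c * harmonicSum N k α := by
  simp only [harmonicSum, mul_left_comm _ c, mul_finsum_mem]

end Harmonic

/-! ### Twisted central values `L(f ⊗ ψ, ½)` -/

section Twisted

variable {N : ℕ} [NeZero N] {k : ℤ} {m : ℕ} [NeZero m]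

/-- The **twisted central value** `L(f ⊗ ψ, ½)` of `f ∈ S_k(Γ₀(N))` by a PRIMITIVE Dirichlet character
`ψ mod m`, in the analytic normalisation: the central value of the raw Shimura twist
`twistRaw (N m²) f ψ = ∑_u ψ̄(u) f(· + u/m) = g(ψ̄) · ∑ ψ(n) a_n(f) qⁿ ∈ S_k(Γ₁(N m²))`
(Shimura 1971, Prop. 3.64; Iwaniec–Kowalski (14.52) `(f ⊗ ψ)(z) = τ(ψ̄)⁻¹ ∑_u ψ̄(u) f(z + u/r)`;
tree `cuspCoeff_twistRaw`) divided by the Gauss sum `g(ψ̄) = gaussSum ψ⁻¹ e(·/m) ≠ 0`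
(`gaussSum_stdAddChar_ne_zero_of_isPrimitive`). Its `L`-series is `twistedLSeries f ψ`
(`cuspFormLSeries_twistRaw`), so this is the central value of the entire continuation of
`L(f ⊗ ψ, s) = ∑ ψ(n) λ_f(n) n^{−s}` (Iwaniec–Kowalski Thm. 26.1: `L(f ⊗ ψ, ½)`; Prop. 14.20 for the
newform `f ⊗ ψ` of level `N m²` when `(m, N) = 1`). For imprimitive `ψ` this is a junk value.
[cite: IwaniecKowalski2004, (14.52), Prop. 14.20, Thm. 26.1] -/
def twistedCentralValue (f : CuspForm (Gamma0 N) k) (ψ : DirichletCharacter ℂ m) : ℂ :=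
  (gaussSum ψ⁻¹ (ZMod.stdAddChar (N := m)))⁻¹ *
    centralValue (twistRaw (N * m ^ 2) (dvd_mul_right N (m ^ 2)) (dvd_mul_left (m ^ 2) N) f ψ)

/-- Unfolding `twistedCentralValue` (Iwaniec–Kowalski (14.52), Thm. 26.1).
[cite: IwaniecKowalski2004, (14.52), Thm. 26.1] -/
theorem twistedCentralValue_def (f : CuspForm (Gamma0 N) k) (ψ : DirichletCharacter ℂ m) :
    twistedCentralValue f ψ =
      (gaussSum ψ⁻¹ (ZMod.stdAddChar (N := m)))⁻¹ *
        centralValue (twistRaw (N * m ^ 2) (dvd_mul_right N (m ^ 2)) (dvd_mul_left (m ^ 2) N) f ψ) :=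
  rfl

/-- The **twisted central derivative** `L'(f ⊗ ψ, ½)`, same construction with `centralDeriv`.
[cite: IwaniecKowalski2004, (14.52), Prop. 14.20] -/
def twistedCentralDeriv (f : CuspForm (Gamma0 N) k) (ψ : DirichletCharacter ℂ m) : ℂ :=
  (gaussSum ψ⁻¹ (ZMod.stdAddChar (N := m)))⁻¹ *
    centralDeriv (twistRaw (N * m ^ 2) (dvd_mul_right N (m ^ 2)) (dvd_mul_left (m ^ 2) N) f ψ)

/-- **The `L`-series of the raw twist is `g(ψ̄)` times the twisted `L`-series**:
`L(twistRaw f ψ, s) = g(ψ⁻¹) · L(f ⊗ ψ, s)` for primitive `ψ` (all `s`; both sides are `LSeries`),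
from the tree's `cuspCoeff_twistRaw` (Shimura 1971, Prop. 3.64 / Thm. 3.66).
[cite: Shimura1971, Prop. 3.64 / Thm. 3.66] -/
theorem cuspFormLSeries_twistRaw (L : ℕ) [NeZero L] (hN : N ∣ L) (hm : m ^ 2 ∣ L)
    (f : CuspForm (Gamma0 N) k) {ψ : DirichletCharacter ℂ m} (hψ : ψ.IsPrimitive) (s : ℂ) :
    cuspFormLSeries (twistRaw L hN hm f ψ) s =
      gaussSum ψ⁻¹ (ZMod.stdAddChar (N := m)) * twistedLSeries f ψ s := by
  rw [cuspFormLSeries, twistedLSeries, LSeries, LSeries, ← tsum_mul_left]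
  congr 1
  funext n
  rw [LSeries.term_def, LSeries.term_def]
  split_ifs with h
  · simp
  · rw [cuspCoeff_twistRaw L hN hm f hψ n]
    ring

/-- For a primitive QUADRATIC `ψ` the raw twist is `g(ψ̄)` times the tree's twist `charTwist` on
`Γ₀(N m²)`, hence `L(f ⊗ ψ, ½) = g(ψ̄)⁻¹ · L(twistRaw f ψ)(½)` is ALSO the central value computed
from `charTwist` once the two Mellin transforms are identified — recorded here as the equality of the
underlying functions on `ℍ` (`coe_charTwist`), which is all the Mellin transform sees (Shimura 1971,
Prop. 3.64: `f_χ = g(χ̄)⁻¹ ∑_u χ̄(u) f(· + u/m)`). [cite: Shimura1971, Prop. 3.64] -/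
theorem coe_twistRaw_eq_gaussSum_smul_coe_charTwist (L : ℕ) [NeZero L] (hN : N ∣ L) (hm : m ^ 2 ∣ L)
    {ψ : DirichletCharacter ℂ m} (hψ : ψ.IsQuadratic) (hprim : ψ.IsPrimitive)
    (f : CuspForm (Gamma0 N) k) :
    (⇑(twistRaw L hN hm f ψ) : ℍ → ℂ) =
      gaussSum ψ⁻¹ (ZMod.stdAddChar (N := m)) • (⇑(charTwist L hN hm hψ f) : ℍ → ℂ) := by
  have hg : gaussSum ψ⁻¹ (ZMod.stdAddChar (N := m)) ≠ 0 :=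
    gaussSum_stdAddChar_ne_zero_of_isPrimitive (isPrimitive_inv hprim)
  rw [coe_charTwist, smul_smul, mul_inv_cancel₀ hg, one_smul]

/-- Consequently the Mellin transforms agree up to the Gauss sum:
`Λ(twistRaw f ψ, s) = g(ψ̄) · Λ(charTwist f ψ, s)` (primitive quadratic `ψ`; Shimura 1971, Prop. 3.64).
[cite: Shimura1971, Prop. 3.64] -/
theorem cuspFormMellin_twistRaw_eq (L : ℕ) [NeZero L] (hN : N ∣ L) (hm : m ^ 2 ∣ L)
    {ψ : DirichletCharacter ℂ m} (hψ : ψ.IsQuadratic) (hprim : ψ.IsPrimitive)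
    (f : CuspForm (Gamma0 N) k) (s : ℂ) :
    cuspFormMellin (twistRaw L hN hm f ψ) s =
      gaussSum ψ⁻¹ (ZMod.stdAddChar (N := m)) * cuspFormMellin (charTwist L hN hm hψ f) s := by
  rw [cuspFormMellin, cuspFormMellin, coe_twistRaw_eq_gaussSum_smul_coe_charTwist L hN hm hψ hprim f,
    ← smul_eq_mul, ← mellin_const_smul]
  rfl

/-- **Quadratic twists via `charTwist`**: for a primitive quadratic `ψ mod m`,
`L(f ⊗ ψ, ½) = centralValue (charTwist (N m²) f ψ)` — the twisted central value is the central value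
of the honest cusp form `f ⊗ ψ ∈ S_k(Γ₀(N m²))` (Shimura 1971, Prop. 3.64; Iwaniec–Kowalski
Prop. 14.20). [cite: IwaniecKowalski2004, Prop. 14.20] -/
theorem twistedCentralValue_eq_centralValue_charTwist {ψ : DirichletCharacter ℂ m}
    (hψ : ψ.IsQuadratic) (hprim : ψ.IsPrimitive) (f : CuspForm (Gamma0 N) k) :
    twistedCentralValue f ψ =
      centralValue (charTwist (N * m ^ 2) (dvd_mul_right N (m ^ 2)) (dvd_mul_left (m ^ 2) N) hψ f) := by
  have hg : gaussSum ψ⁻¹ (ZMod.stdAddChar (N := m)) ≠ 0 :=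
    gaussSum_stdAddChar_ne_zero_of_isPrimitive (isPrimitive_inv hprim)
  rw [twistedCentralValue, centralValue, centralValue, cuspFormLStar, cuspFormLStar,
    cuspFormMellin_twistRaw_eq _ _ _ hψ hprim]
  set g := gaussSum ψ⁻¹ (ZMod.stdAddChar (N := m))
  set A := (2 * Real.pi : ℂ) ^ ((k : ℂ) / 2) / Complex.Gamma ((k : ℂ) / 2)
  set M := cuspFormMellin (charTwist (N * m ^ 2) (dvd_mul_right N (m ^ 2)) (dvd_mul_left (m ^ 2) N)
    hψ f) ((k : ℂ) / 2)
  calc g⁻¹ * (A * (g * M)) = g⁻¹ * g * (A * M) := by ring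
    _ = A * M := by rw [inv_mul_cancel₀ hg, one_mul]

end Twisted


end Literature.NumberTheory.LFunctions.GL2Family
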